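import Literature.Probability.RandomPlanarGeometry.HexSAWStripWidthTwoKernel
import HarnessLib

/-!
# Three crossings of every internal cut of an irreducible strip bridge; the rails of the width-three strip `S₃` and the
# forcing tools (module «STRIP-CUT-CROSSINGS»)

Topic `Literature/Probability/RandomPlanarGeometry` (continues the strip renewal line: «BRIDGE-RENEWAL» `HexSAWStripBridgeRenewal.lean` —
the Duminil-Copin–Hammond renewal indices `HV.IsRenewalIdx`, irreducible bridges, the level classes `HV.HBk T N k a b`; «WIDTH-TWO-KERNEL»
`HexSAWStripWidthTwoKernel.lean` #715 — the six irreducible bridges of `S₂` by the no-return lemma `HV.W2.isRenewalIdx_of_column`).  Lane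
«pcv-sawmu» (CriticalPhenomena venture), a-p2 g25, HANDOFF-gen24 §Recommended 4 («WIDTH-THREE-KERNEL», suggested route steps 1–2).
Sources of the SETTING: H. Duminil-Copin, A. Hammond, CMP 324 (2013) §2.2 (bridges `ω₁(0) < ω₁(i) ≤ ω₁(n)`, renewal points, irreducible
bridges); H. Duminil-Copin, S. Smirnov, Ann. Math. 175 (2012) §3 (the strip `S_T` of the hexagonal lattice, Fig. 3); N. Madras, G. Slade,
*The Self-Avoiding Walk* (1993) §1.1 (walks as self-avoiding nearest-neighbour vertex sequences).  Nothing below is printed: the sources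
define the objects; the cut-crossing count and the rail structure of `S₃` are this lane's (elementary) lemmas.

## What is proved (namespace `Literature.Probability.RandomPlanarGeometry.SAW.HV`; width-three objects in `HV.W3`)

* §1 (every width) `exists_last_exit`, `exists_first_entry` and ★★ **`three_crossings`**: on a horizontal bridge with adjacent consecutive
  vertices and NO renewal index, every cut `c + ½` with `ξ(head) < c < ξ(last)` is crossed by (at least) three steps `p < q < r` —
  rightward at `p` (first entry), leftward at `q`, rightward at `r` (last exit) — with all vertices up to `p` in `{ξ ≤ c}` and all vertices
  after `r` in `{ξ ≥ c+1}`.  (One crossing would make the last exit a renewal index; `ξ` moves by at most one per step, `xi_adj`.)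
* §2 (`S₃`: levels `0 … 5`, `lev = 2x₁ + b`, column `ξ = 2x₀ + x₁ + b`) `W3.eq_of_xi_eq_even/odd`: the even column `2a` holds `(a,0,f)` (level 0),
  `(a−1,1,t)` (3), `(a−1,2,f)` (4); the odd column `2a+1` holds `(a,0,t)` (1), `(a,1,f)` (2), `(a−1,2,t)` (5); `W3.edge_even/odd`: the three
  edges across a cut, one per rail `b = 0, 1, 2` (levels `{0,1}`, `{2,3}`, `{4,5}`); the rungs join levels `1–2` (odd columns) and `3–4` (even).
* §3 `W3.false_of_two_traversals` (a self-avoiding list traverses an edge at most once), `W3.step_even/odd` (a step across a cut of `S₃` is a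
  rail edge), and the tool notion `Trav l u v` (the list traverses the edge `{u,v}` at some step, in either direction).
* §4 Forcing tools in the `l[i]? = some v` idiom (no dependent indices): `next_of_trav` (a traversed edge at whose endpoint the walk sits,
  not just coming from the other endpoint, is the next step), `length_gt_of_trav`, `dead_end` (a vertex all of whose list-neighbours are
  one vertex `z` is the last vertex, preceded by `z`), `next_of_two`, `xi_bounds_of_mem`, `lt_length_of_xi_lt`, `idx_unique`, `adj_of_at`.
* §5 ★★ **`W3.trav_even` / `W3.trav_odd`**: an irreducible self-avoiding bridge of `S₃` traverses ALL THREE rail edges across every internal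
  cut `c + ½`, `ξ(head) < c < ξ(last)` (three crossings by §1, pairwise distinct edges by §3, only three edges available by §2).

These feed «WIDTH-THREE-CLASSIFICATION» (`HexSAWStripWidthThreeClassification.lean`: the irreducible bridges of `S₃` are ten short lists
and two serpentine families).  Label: LANE LEMMAS (own, elementary), a-p2 g25 2026-08-27.  NOT claimed: anything printed; any statement for
`T ≥ 4` beyond §1 (which holds for every width).
-/

noncomputable section

open Finset Literature.Probability.LatticeModels Literature.Probability.Percolation

namespace Literature.Probability.RandomPlanarGeometry.SAW

namespace HV

variable {l : List HV}

/-! ### §1 The last exit from a half-strip and the three crossings of an internal cut (every width) -/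

/-- **Last exit.**  On a horizontal bridge whose consecutive vertices are adjacent, for every column `c` with
`ξ(head) ≤ c < ξ(last)` there is a LAST index `i` with `ξ(l[i]) ≤ c`; there `ξ(l[i]) = c`, `ξ(l[i+1]) = c + 1`, and every later
vertex has `ξ ≥ c + 1` (`ξ` moves by at most one per step). [cite: DuminilCopinHammond2013, §2.2 (bridges, renewal points); lane «pcv-sawmu» a-p2 g25] -/
theorem exists_last_exit (hc : l.IsChain hvGraph.Adj) (hB : IsHBridge l) {c : ℤ} (h0 : xi (l.head hB.1) ≤ c)
    (hE : c < xi (l.getLast hB.1)) :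
    ∃ i, ∃ hi : i + 1 < l.length, xi l[i] = c ∧ xi l[i + 1] = c + 1 ∧
      (∀ j, ∀ hj : j < l.length, i < j → c + 1 ≤ xi l[j]) := by
  classical
  obtain ⟨hne, hbr⟩ := hB
  have hlen : 0 < l.length := List.length_pos_of_ne_nil hne
  set S : Finset ℕ := (range l.length).filter fun j => xiAt l j ≤ c with hS
  have h0S : 0 ∈ S := by
    rw [hS, mem_filter, mem_range, xiAt_eq_xi_getElem hlen, ← List.head_eq_getElem hne]
    exact ⟨hlen, h0⟩
  have hSne : S.Nonempty := ⟨0, h0S⟩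
  obtain ⟨i, hi⟩ : ∃ i, i = S.max' hSne := ⟨_, rfl⟩
  have hiS : i ∈ S := hi ▸ max'_mem S hSne
  rw [hS, mem_filter, mem_range] at hiS
  obtain ⟨hil, hic⟩ := hiS
  rw [xiAt_eq_xi_getElem hil] at hic
  -- `i` is not the last index
  have hilast : i + 1 < l.length := by
    by_contra h
    have heq : i = l.length - 1 := by omega
    have : xi (l.getLast hne) ≤ c := by
      rw [List.getLast_eq_getElem]; simp only [← heq]; exact hic
    omega
  have hafter : ∀ j, ∀ hj : j < l.length, i < j → c + 1 ≤ xi l[j] := by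
    intro j hj hij
    by_contra h
    have hjS : j ∈ S := by
      rw [hS, mem_filter, mem_range, xiAt_eq_xi_getElem hj]; exact ⟨hj, by omega⟩
    have := hi ▸ le_max' S j hjS
    omega
  have hnext := hafter (i + 1) hilast (by omega)
  have hstep := xi_adj (List.isChain_iff_getElem.1 hc i hilast)
  refine ⟨i, hilast, by omega, by omega, hafter⟩

/-- **First entry.**  Symmetrically: if some vertex `l[j]`, `j ≤ i`, has `ξ ≥ c + 1` while `ξ(head) ≤ c`, then there is a FIRST index
`p + 1 ≤ j` with `ξ(l[p+1]) ≥ c + 1`; there `ξ(l[p]) = c`, `ξ(l[p+1]) = c + 1` and all earlier vertices have `ξ ≤ c`.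
[cite: DuminilCopinHammond2013, §2.2 (bridges, renewal points); lane «pcv-sawmu» a-p2 g25] -/
theorem exists_first_entry (hc : l.IsChain hvGraph.Adj) (hne : l ≠ []) {c : ℤ} (h0 : xi (l.head hne) ≤ c)
    {j : ℕ} (hj : j < l.length) (hjc : c + 1 ≤ xi l[j]) :
    ∃ p, ∃ hp : p + 1 ≤ j, xi (l[p]'(by omega)) = c ∧ xi (l[p + 1]'(by omega)) = c + 1 ∧
      (∀ m, ∀ hm : m ≤ p, xi (l[m]'(by omega)) ≤ c) := by
  classical
  have hlen : 0 < l.length := List.length_pos_of_ne_nil hne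
  set S : Finset ℕ := (range l.length).filter fun m => c + 1 ≤ xiAt l m with hS
  have hjS : j ∈ S := by
    rw [hS, mem_filter, mem_range, xiAt_eq_xi_getElem hj]; exact ⟨hj, hjc⟩
  have hSne : S.Nonempty := ⟨j, hjS⟩
  obtain ⟨q, hq⟩ : ∃ q, q = S.min' hSne := ⟨_, rfl⟩
  have hqS : q ∈ S := hq ▸ min'_mem S hSne
  rw [hS, mem_filter, mem_range] at hqS
  obtain ⟨hql, hqc⟩ := hqS
  rw [xiAt_eq_xi_getElem hql] at hqc
  have hqj : q ≤ j := hq ▸ min'_le S j hjS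
  have hq0 : q ≠ 0 := by
    intro hq0
    have : xi l[q] = xi (l.head hne) := by rw [List.head_eq_getElem hne]; simp only [hq0]
    omega
  have hbefore : ∀ m, ∀ hm : m < q, xi (l[m]'(by omega)) ≤ c := by
    intro m hm
    by_contra h
    have hmS : m ∈ S := by
      rw [hS, mem_filter, mem_range, xiAt_eq_xi_getElem (by omega)]; exact ⟨by omega, by omega⟩
    have := hq ▸ min'_le S m hmS
    omega
  obtain ⟨p, hpq⟩ : ∃ p, q = p + 1 := ⟨q - 1, by omega⟩
  have hprev := hbefore p (by omega)
  have hql' : p + 1 < l.length := by omega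
  have hstep := xi_adj (List.isChain_iff_getElem.1 hc p hql')
  have hqc' : c + 1 ≤ xi l[p + 1] := by simp only [← hpq]; exact hqc
  exact ⟨p, by omega, by omega, by omega, fun m hm => hbefore m (by omega)⟩

/-- **Three crossings.**  Let `l` be a horizontal bridge with adjacent consecutive vertices and NO renewal index (an irreducible
bridge).  Then every cut `c + ½` strictly inside it (`ξ(head) < c < ξ(last)`) is crossed at least three times: there are indices
`p < q < r` with `ξ(l[p]) = c, ξ(l[p+1]) = c+1` (first entry), `ξ(l[q]) = c+1, ξ(l[q+1]) = c` (a return), `ξ(l[r]) = c, ξ(l[r+1]) = c+1`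
(last exit), all vertices up to `p` in `{ξ ≤ c}` and all vertices after `r` in `{ξ ≥ c+1}`.  (If the cut were crossed once, the
last exit `r` would be a renewal index.) [cite: DuminilCopinHammond2013, §2.2 (renewal points, irreducible bridges); lane «pcv-sawmu» a-p2 g25 — own lemma] -/
theorem three_crossings (hc : l.IsChain hvGraph.Adj) (hB : IsHBridge l) (hirr : ∀ i, ¬ IsRenewalIdx l i) {c : ℤ}
    (h0 : xi (l.head hB.1) < c) (hE : c < xi (l.getLast hB.1)) :
    ∃ p q r : ℕ, ∃ (hpq : p < q) (hqr : q < r) (hr : r + 1 < l.length),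
      xi (l[p]'(by omega)) = c ∧ xi (l[p + 1]'(by omega)) = c + 1 ∧
      xi (l[q]'(by omega)) = c + 1 ∧ xi (l[q + 1]'(by omega)) = c ∧
      xi l[r] = c ∧ xi l[r + 1] = c + 1 ∧
      (∀ m, ∀ hm : m ≤ p, xi (l[m]'(by omega)) ≤ c) ∧ (∀ j, ∀ hj : j < l.length, r < j → c + 1 ≤ xi l[j]) := by
  classical
  obtain ⟨hne, hbr⟩ := hB
  obtain ⟨r, hr, hrc, hrc1, hafter⟩ := exists_last_exit hc ⟨hne, hbr⟩ h0.le hE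
  -- `r` is not a renewal index, so some earlier vertex lies beyond the cut
  have hr0 : 0 < r := by
    rcases Nat.eq_zero_or_pos r with rfl | h
    · rw [← List.head_eq_getElem hne] at hrc; omega
    · exact h
  have hex : ∃ j, ∃ hj : j < r, c + 1 ≤ xi (l[j]'(by omega)) := by
    by_contra hno
    simp only [not_exists, not_le] at hno
    refine hirr r ⟨hr0, hr, fun j hj => ?_, fun j hj hrj => ?_⟩
    · rw [mem_range] at hj
      rw [xiAt_eq_xi_getElem (by omega), xiAt_eq_xi_getElem (by omega), hrc]
      rcases Nat.lt_succ_iff_lt_or_eq.1 hj with h | rfl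
      · have := hno j h; omega
      · exact hrc.le
    · rw [mem_range] at hj
      rw [xiAt_eq_xi_getElem (by omega), xiAt_eq_xi_getElem hj, hrc]
      have := hafter j hj hrj; omega
  obtain ⟨j, hj, hjc⟩ := hex
  obtain ⟨p, hp, hpc, hpc1, hbefore⟩ := exists_first_entry hc hne h0.le (by omega : j < l.length) hjc
  -- between `p + 1 ≤ j < r` the walk returns to `{ξ ≤ c}` (at `r`): first return `q + 1`
  set S : Finset ℕ := (range (r + 1)).filter fun m => j < m ∧ xiAt l m ≤ c with hS
  have hrS : r ∈ S := by
    rw [hS, mem_filter, mem_range, xiAt_eq_xi_getElem (by omega)]; exact ⟨by omega, hj, hrc.le⟩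
  have hSne : S.Nonempty := ⟨r, hrS⟩
  obtain ⟨t, ht⟩ : ∃ t, t = S.min' hSne := ⟨_, rfl⟩
  have htS : t ∈ S := ht ▸ min'_mem S hSne
  rw [hS, mem_filter, mem_range] at htS
  obtain ⟨htr, hjt, htc⟩ := htS
  rw [xiAt_eq_xi_getElem (by omega)] at htc
  obtain ⟨q, htq⟩ : ∃ q, t = q + 1 := ⟨t - 1, by omega⟩
  have htc' : xi (l[q + 1]'(by omega)) ≤ c := by simp only [← htq]; exact htc
  have hqc : c + 1 ≤ xi (l[q]'(by omega)) := by
    rcases Nat.lt_or_ge j q with hjq | hjq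
    · by_contra h
      have hqS : q ∈ S := by
        rw [hS, mem_filter, mem_range, xiAt_eq_xi_getElem (by omega)]; exact ⟨by omega, hjq, by omega⟩
      have := ht ▸ min'_le S q hqS
      omega
    · have hqj : q = j := by omega
      simp only [hqj]; exact hjc
  have hstep := xi_adj (List.isChain_iff_getElem.1 hc q (by omega))
  refine ⟨p, q, r, by omega, by omega, hr, hpc, hpc1, by omega, by omega, hrc, hrc1, hbefore, hafter⟩


/-! ### §2 The columns of `S₃`, and the three rail edges across each cut -/

namespace W3

/-- The even column `2a` of `S₃` holds three vertices: `(a,0,f)` (level 0, no rung inside the strip), `(a−1,1,t)` (level 3) and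
`(a−1,2,f)` (level 4) — the last two joined by a rung. [cite: DuminilCopinSmirnov2012, §3 (Fig. 3: the strip S_T); lane «pcv-sawmu» a-p2 g25] -/
theorem eq_of_xi_eq_even {v : HV} (h0 : 0 ≤ lev v) (h5 : lev v ≤ 2 * (3 : ℕ) - 1) (a : ℤ) (hc : xi v = 2 * a) :
    v = (a, 0, false) ∨ v = (a - 1, 1, true) ∨ v = (a - 1, 2, false) := by
  obtain ⟨a', b', c'⟩ := v
  cases c' <;> simp [xi, bit] at h0 h5 hc ⊢ <;> omega

/-- The odd column `2a + 1` of `S₃` holds `(a,0,t)` (level 1), `(a,1,f)` (level 2) — joined by a rung — and `(a−1,2,t)` (level 5, no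
rung inside the strip). [cite: DuminilCopinSmirnov2012, §3 (Fig. 3: the strip S_T); lane «pcv-sawmu» a-p2 g25] -/
theorem eq_of_xi_eq_odd {v : HV} (h0 : 0 ≤ lev v) (h5 : lev v ≤ 2 * (3 : ℕ) - 1) (a : ℤ) (hc : xi v = 2 * a + 1) :
    v = (a, 0, true) ∨ v = (a, 1, false) ∨ v = (a - 1, 2, true) := by
  obtain ⟨a', b', c'⟩ := v
  cases c' <;> simp [xi, bit] at h0 h5 hc ⊢ <;> omega

/-- The three edges of `S₃` across the cut `2a + ½` (from the even column `2a` to the odd column `2a+1`), one per rail `b = 0, 1, 2`: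
`(a,0,f)–(a,0,t)`, `(a−1,1,t)–(a,1,f)`, `(a−1,2,f)–(a−1,2,t)`; the rail is read off the middle coordinate. [cite: DuminilCopinSmirnov2012, §3 (Fig. 3: the strip S_T); lane «pcv-sawmu» a-p2 g25] -/
theorem edge_even {u v : HV} (huv : hvGraph.Adj u v) (hu0 : 0 ≤ lev u) (hu5 : lev u ≤ 2 * (3 : ℕ) - 1) (hv0 : 0 ≤ lev v)
    (hv5 : lev v ≤ 2 * (3 : ℕ) - 1) (a : ℤ) (hcu : xi u = 2 * a) (hcv : xi v = 2 * a + 1) :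
    (u = (a, 0, false) ∧ v = (a, 0, true)) ∨ (u = (a - 1, 1, true) ∧ v = (a, 1, false)) ∨
      (u = (a - 1, 2, false) ∧ v = (a - 1, 2, true)) := by
  rcases eq_of_xi_eq_even hu0 hu5 a hcu with rfl | rfl | rfl <;>
    rcases eq_of_xi_eq_odd hv0 hv5 a hcv with rfl | rfl | rfl <;>
    simp [hvGraph_adj, AdjRel] at huv ⊢

/-- The three edges of `S₃` across the cut `2a + 1 + ½` (odd column `2a+1` to even column `2a+2`): `(a,0,t)–(a+1,0,f)`,
`(a,1,f)–(a,1,t)`, `(a−1,2,t)–(a,2,f)`. [cite: DuminilCopinSmirnov2012, §3 (Fig. 3: the strip S_T); lane «pcv-sawmu» a-p2 g25] -/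
theorem edge_odd {u v : HV} (huv : hvGraph.Adj u v) (hu0 : 0 ≤ lev u) (hu5 : lev u ≤ 2 * (3 : ℕ) - 1) (hv0 : 0 ≤ lev v)
    (hv5 : lev v ≤ 2 * (3 : ℕ) - 1) (a : ℤ) (hcu : xi u = 2 * a + 1) (hcv : xi v = 2 * (a + 1)) :
    (u = (a, 0, true) ∧ v = (a + 1, 0, false)) ∨ (u = (a, 1, false) ∧ v = (a, 1, true)) ∨
      (u = (a - 1, 2, true) ∧ v = (a, 2, false)) := by
  rcases eq_of_xi_eq_odd hu0 hu5 a hcu with rfl | rfl | rfl <;>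
    rcases eq_of_xi_eq_even hv0 hv5 (a + 1) hcv with rfl | rfl | rfl <;>
    simp [hvGraph_adj, AdjRel] at huv ⊢

/-! ### §3 An edge is traversed at most once; a step across a cut of `S₃` is a rail edge; the notion `Trav` -/

/-- Two different steps of a self-avoiding list never traverse the same edge `{u, v}` (in either direction). [cite: MadrasSlade1993, §1.1 (self-avoiding walks visit each site once); lane plumbing] -/
theorem false_of_two_traversals {l : List HV} (hnd : l.Nodup) {u v : HV} {m m' : ℕ} (hm : m + 1 < l.length)
    (hm' : m' + 1 < l.length) (hne : m ≠ m')
    (h1 : (l[m] = u ∧ l[m + 1] = v) ∨ (l[m] = v ∧ l[m + 1] = u))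
    (h2 : (l[m'] = u ∧ l[m' + 1] = v) ∨ (l[m'] = v ∧ l[m' + 1] = u)) : False := by
  have key : ∀ {i j : ℕ} (hi : i < l.length) (hj : j < l.length), l[i] = l[j] → i = j :=
    fun hi hj h => (hnd.getElem_inj_iff).1 h
  rcases h1 with ⟨h1a, h1b⟩ | ⟨h1a, h1b⟩ <;> rcases h2 with ⟨h2a, h2b⟩ | ⟨h2a, h2b⟩
  · exact hne (key (by omega) (by omega) (h1a.trans h2a.symm))
  · have e1 := key (by omega) (by omega) (h1a.trans h2b.symm)
    have e2 := key (by omega) (by omega) (h1b.trans h2a.symm)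
    omega
  · have e1 := key (by omega) (by omega) (h1a.trans h2b.symm)
    have e2 := key (by omega) (by omega) (h1b.trans h2a.symm)
    omega
  · exact hne (key (by omega) (by omega) (h1a.trans h2a.symm))

/-- A step of a list of `S₃` across the cut `2a + ½` (in either direction) traverses one of the three rail edges.
[cite: DuminilCopinSmirnov2012, §3 (Fig. 3: the strip S_T); lane «pcv-sawmu» a-p2 g25] -/
theorem step_even {l : List HV} (hc : l.IsChain hvGraph.Adj) (hin : InLev 3 l) {m : ℕ} (hm : m + 1 < l.length) (a : ℤ)
    (hx : (xi l[m] = 2 * a ∧ xi l[m + 1] = 2 * a + 1) ∨ (xi l[m] = 2 * a + 1 ∧ xi l[m + 1] = 2 * a)) :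
    ((l[m] = (a, 0, false) ∧ l[m + 1] = (a, 0, true)) ∨ (l[m] = (a, 0, true) ∧ l[m + 1] = (a, 0, false))) ∨
    ((l[m] = (a - 1, 1, true) ∧ l[m + 1] = (a, 1, false)) ∨ (l[m] = (a, 1, false) ∧ l[m + 1] = (a - 1, 1, true))) ∨
    ((l[m] = (a - 1, 2, false) ∧ l[m + 1] = (a - 1, 2, true)) ∨ (l[m] = (a - 1, 2, true) ∧ l[m + 1] = (a - 1, 2, false))) := by
  have hadj := List.isChain_iff_getElem.1 hc m hm
  have h1 := hin _ (List.getElem_mem (by omega : m < l.length))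
  have h2 := hin _ (List.getElem_mem hm)
  rcases hx with ⟨hx1, hx2⟩ | ⟨hx1, hx2⟩
  · rcases edge_even hadj h1.1 h1.2 h2.1 h2.2 a hx1 hx2 with ⟨e1, e2⟩ | ⟨e1, e2⟩ | ⟨e1, e2⟩
    · exact Or.inl (Or.inl ⟨e1, e2⟩)
    · exact Or.inr (Or.inl (Or.inl ⟨e1, e2⟩))
    · exact Or.inr (Or.inr (Or.inl ⟨e1, e2⟩))
  · rcases edge_even hadj.symm h2.1 h2.2 h1.1 h1.2 a hx2 hx1 with ⟨e1, e2⟩ | ⟨e1, e2⟩ | ⟨e1, e2⟩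
    · exact Or.inl (Or.inr ⟨e2, e1⟩)
    · exact Or.inr (Or.inl (Or.inr ⟨e2, e1⟩))
    · exact Or.inr (Or.inr (Or.inr ⟨e2, e1⟩))

/-- A step of a list of `S₃` across the cut `2a + 1 + ½` (in either direction) traverses one of the three rail edges.
[cite: DuminilCopinSmirnov2012, §3 (Fig. 3: the strip S_T); lane «pcv-sawmu» a-p2 g25] -/
theorem step_odd {l : List HV} (hc : l.IsChain hvGraph.Adj) (hin : InLev 3 l) {m : ℕ} (hm : m + 1 < l.length) (a : ℤ)
    (hx : (xi l[m] = 2 * a + 1 ∧ xi l[m + 1] = 2 * a + 1 + 1) ∨ (xi l[m] = 2 * a + 1 + 1 ∧ xi l[m + 1] = 2 * a + 1)) :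
    ((l[m] = (a, 0, true) ∧ l[m + 1] = (a + 1, 0, false)) ∨ (l[m] = (a + 1, 0, false) ∧ l[m + 1] = (a, 0, true))) ∨
    ((l[m] = (a, 1, false) ∧ l[m + 1] = (a, 1, true)) ∨ (l[m] = (a, 1, true) ∧ l[m + 1] = (a, 1, false))) ∨
    ((l[m] = (a - 1, 2, true) ∧ l[m + 1] = (a, 2, false)) ∨ (l[m] = (a, 2, false) ∧ l[m + 1] = (a - 1, 2, true))) := by
  have hadj := List.isChain_iff_getElem.1 hc m hm
  have h1 := hin _ (List.getElem_mem (by omega : m < l.length))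
  have h2 := hin _ (List.getElem_mem hm)
  rcases hx with ⟨hx1, hx2⟩ | ⟨hx1, hx2⟩
  · rcases edge_odd hadj h1.1 h1.2 h2.1 h2.2 a hx1 (by rw [hx2]; ring) with ⟨e1, e2⟩ | ⟨e1, e2⟩ | ⟨e1, e2⟩
    · exact Or.inl (Or.inl ⟨e1, e2⟩)
    · exact Or.inr (Or.inl (Or.inl ⟨e1, e2⟩))
    · exact Or.inr (Or.inr (Or.inl ⟨e1, e2⟩))
  · rcases edge_odd hadj.symm h2.1 h2.2 h1.1 h1.2 a hx2 (by rw [hx1]; ring) with ⟨e1, e2⟩ | ⟨e1, e2⟩ | ⟨e1, e2⟩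
    · exact Or.inl (Or.inr ⟨e2, e1⟩)
    · exact Or.inr (Or.inl (Or.inr ⟨e2, e1⟩))
    · exact Or.inr (Or.inr (Or.inr ⟨e2, e1⟩))

end W3

/-- The vertex list `l` **traverses the edge `{u, v}`** (at some step, in either direction). [cite: MadrasSlade1993, §1.1 (walks as vertex sequences); lane tool notion] -/
def Trav (l : List HV) (u v : HV) : Prop := ∃ m, ∃ hm : m + 1 < l.length, (l[m] = u ∧ l[m + 1] = v) ∨ (l[m] = v ∧ l[m + 1] = u)


/-! ### §4 Forcing tools: a traversed edge fixes the next vertex; dead ends (positions as `l[i]? = some v`) -/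

/-- `Trav` is symmetric in the edge's endpoints (plumbing). [cite: MadrasSlade1993, §1.1; lane plumbing] -/
theorem Trav.symm {l : List HV} {u v : HV} (h : Trav l u v) : Trav l v u := by
  obtain ⟨m, hm, h⟩ := h
  exact ⟨m, hm, h.symm⟩

/-- Both endpoints of a traversed edge are vertices of the list (plumbing). [cite: MadrasSlade1993, §1.1; lane plumbing] -/
theorem Trav.mem {l : List HV} {u v : HV} (h : Trav l u v) : u ∈ l ∧ v ∈ l := by
  obtain ⟨m, hm, ⟨h1, h2⟩ | ⟨h1, h2⟩⟩ := h
  · exact ⟨h1 ▸ List.getElem_mem (by omega), h2 ▸ List.getElem_mem hm⟩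
  · exact ⟨h2 ▸ List.getElem_mem hm, h1 ▸ List.getElem_mem (by omega)⟩

/-- `Trav` in terms of optional indexing (plumbing). [cite: MadrasSlade1993, §1.1; lane plumbing] -/
theorem trav_iff {l : List HV} {u v : HV} :
    Trav l u v ↔ ∃ m, (l[m]? = some u ∧ l[m + 1]? = some v) ∨ (l[m]? = some v ∧ l[m + 1]? = some u) := by
  constructor
  · rintro ⟨m, hm, ⟨h1, h2⟩ | ⟨h1, h2⟩⟩
    · exact ⟨m, Or.inl ⟨by rw [List.getElem?_eq_getElem (by omega), h1], by rw [List.getElem?_eq_getElem hm, h2]⟩⟩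
    · exact ⟨m, Or.inr ⟨by rw [List.getElem?_eq_getElem (by omega), h1], by rw [List.getElem?_eq_getElem hm, h2]⟩⟩
  · rintro ⟨m, ⟨h1, h2⟩ | ⟨h1, h2⟩⟩
    · obtain ⟨hm, h2'⟩ := List.getElem?_eq_some_iff.1 h2
      obtain ⟨hm0, h1'⟩ := List.getElem?_eq_some_iff.1 h1
      exact ⟨m, hm, Or.inl ⟨h1', h2'⟩⟩
    · obtain ⟨hm, h2'⟩ := List.getElem?_eq_some_iff.1 h2
      obtain ⟨hm0, h1'⟩ := List.getElem?_eq_some_iff.1 h1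
      exact ⟨m, hm, Or.inr ⟨h1', h2'⟩⟩

/-- In a self-avoiding list a vertex has at most one position (plumbing). [cite: MadrasSlade1993, §1.1 (self-avoidance); lane plumbing] -/
theorem idx_unique {l : List HV} (hnd : l.Nodup) {i j : ℕ} {a : HV} (hi : l[i]? = some a) (hj : l[j]? = some a) : i = j := by
  obtain ⟨hi', rfl⟩ := List.getElem?_eq_some_iff.1 hi
  obtain ⟨hj', h⟩ := List.getElem?_eq_some_iff.1 hj
  exact (hnd.getElem_inj_iff.1 h).symm

/-- Consecutive positions hold adjacent vertices (plumbing). [cite: MadrasSlade1993, §1.1 (nearest-neighbour steps); lane plumbing] -/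
theorem adj_of_at {l : List HV} (hc : l.IsChain hvGraph.Adj) {i : ℕ} {u v : HV} (hu : l[i]? = some u) (hv : l[i + 1]? = some v) :
    hvGraph.Adj u v := by
  obtain ⟨hi, rfl⟩ := List.getElem?_eq_some_iff.1 hu
  obtain ⟨hi', rfl⟩ := List.getElem?_eq_some_iff.1 hv
  exact List.isChain_iff_getElem.1 hc i hi'

/-- **Forcing along a traversed edge.**  If the self-avoiding list traverses `{u, v}`, sits at `u` at time `m`, and was NOT at `v` at
time `m − 1`, then it is at `v` at time `m + 1`. [cite: MadrasSlade1993, §1.1 (self-avoidance); lane «pcv-sawmu» a-p2 g25] -/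
theorem next_of_trav {l : List HV} (hnd : l.Nodup) {u v : HV} (h : Trav l u v) {m : ℕ} (hu : l[m]? = some u)
    (hprev : ∀ m', m' + 1 = m → l[m']? ≠ some v) : l[m + 1]? = some v := by
  obtain ⟨m', ⟨h1, h2⟩ | ⟨h1, h2⟩⟩ := trav_iff.1 h
  · obtain rfl := idx_unique hnd hu h1; exact h2
  · exact absurd h1 (hprev m' (idx_unique hnd h2 hu))

/-- A traversed edge none of whose endpoints occurs among `l[0..j]` is traversed later: the list has at least `j + 3` vertices.
[cite: MadrasSlade1993, §1.1; lane «pcv-sawmu» a-p2 g25] -/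
theorem length_gt_of_trav {l : List HV} {u v : HV} (h : Trav l u v) {j : ℕ}
    (hfresh : ∀ i ≤ j, l[i]? ≠ some u ∧ l[i]? ≠ some v) : j + 2 < l.length := by
  obtain ⟨m, ⟨h1, h2⟩ | ⟨h1, h2⟩⟩ := trav_iff.1 h
  · have hm : ¬ m ≤ j := fun hm => (hfresh m hm).1 h1
    have := (List.getElem?_eq_some_iff.1 h2).1
    omega
  · have hm : ¬ m ≤ j := fun hm => (hfresh m hm).2 h1
    have := (List.getElem?_eq_some_iff.1 h2).1
    omega

/-- **Dead end.**  If every vertex of the self-avoiding list adjacent to the vertex `w = l[j]` (`j ≥ 1`) equals one vertex `z`, then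
`l[j−1] = z` and `l[j]` is the LAST vertex. [cite: MadrasSlade1993, §1.1 (self-avoidance); lane «pcv-sawmu» a-p2 g25] -/
theorem dead_end {l : List HV} (hc : l.IsChain hvGraph.Adj) (hnd : l.Nodup) {j : ℕ} {w : HV} (hj : l[j]? = some w) (h1 : 1 ≤ j)
    (z : HV) (hz : ∀ w' ∈ l, hvGraph.Adj w w' → w' = z) : l[j - 1]? = some z ∧ j + 1 = l.length := by
  obtain ⟨hjl, rfl⟩ := List.getElem?_eq_some_iff.1 hj
  have hprev : l[j - 1]? = some z := by
    rw [List.getElem?_eq_getElem (by omega), Option.some_inj]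
    refine hz _ (List.getElem_mem (by omega)) ?_
    have := List.isChain_iff_getElem.1 hc (j - 1) (by omega)
    simp only [show j - 1 + 1 = j by omega] at this
    exact this.symm
  refine ⟨hprev, ?_⟩
  by_contra hne
  have hnext : l[j + 1]? = some z := by
    rw [List.getElem?_eq_getElem (by omega), Option.some_inj]
    exact hz _ (List.getElem_mem (by omega)) (List.isChain_iff_getElem.1 hc j (by omega))
  have := idx_unique hnd hprev hnext
  omega

/-- **Two ways on.**  If every vertex of the self-avoiding list adjacent to `w = l[j]` is `z` or `z'`, the list came from `z` and
continues, then it continues to `z'`. [cite: MadrasSlade1993, §1.1 (self-avoidance); lane «pcv-sawmu» a-p2 g25] -/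
theorem next_of_two {l : List HV} (hc : l.IsChain hvGraph.Adj) (hnd : l.Nodup) {j : ℕ} {w : HV} (hj : l[j]? = some w)
    (hj1 : j + 1 < l.length) (h1 : 1 ≤ j) {z z' : HV} (hz : ∀ w' ∈ l, hvGraph.Adj w w' → w' = z ∨ w' = z')
    (hprev : l[j - 1]? = some z) : l[j + 1]? = some z' := by
  obtain ⟨hjl, rfl⟩ := List.getElem?_eq_some_iff.1 hj
  rw [List.getElem?_eq_getElem hj1, Option.some_inj]
  rcases hz _ (List.getElem_mem hj1) (List.isChain_iff_getElem.1 hc j hj1) with h | h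
  · have h' : l[j + 1]? = some z := by rw [List.getElem?_eq_getElem hj1, h]
    have := idx_unique hnd hprev h'
    omega
  · exact h

/-- Membership in a horizontal bridge: a vertex of the list other than the head lies strictly to the right of the head and not
beyond the last vertex (plumbing form of `IsHBridge`). [cite: DuminilCopinHammond2013, §2.2 (bridges); lane plumbing] -/
theorem xi_bounds_of_mem {l : List HV} (hB : IsHBridge l) {w : HV} (hw : w ∈ l) (hne : w ≠ l.head hB.1) :
    xi (l.head hB.1) < xi w ∧ xi w ≤ xi (l.getLast hB.1) := by
  obtain ⟨hne', hbr⟩ := hB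
  have : w ∈ l.tail := by
    rcases l with _ | ⟨v0, t⟩
    · exact absurd rfl hne'
    · simp only [List.head_cons] at hne
      simp only [List.mem_cons] at hw
      rcases hw with rfl | hw
      · exact absurd rfl hne
      · exact hw
  exact hbr w this

/-- The last vertex sits in the last column: a position holding a vertex with `ξ < ξ(last)` is not the last position (plumbing).
[cite: DuminilCopinHammond2013, §2.2 (bridges); lane plumbing] -/
theorem lt_length_of_xi_lt {l : List HV} (hne : l ≠ []) {j : ℕ} {w : HV} (hj : l[j]? = some w)
    (hw : 2 * w.1 + w.2.1 + bit w < xi (l.getLast hne)) : j + 1 < l.length := by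
  obtain ⟨hjl, rfl⟩ := List.getElem?_eq_some_iff.1 hj
  by_contra h
  have : l.getLast hne = l[j] := by rw [List.getLast_eq_getElem]; congr 1; omega
  rw [this, xi] at hw
  exact lt_irrefl _ hw

/-! ### §5 All three rail edges across an internal cut are traversed -/

namespace W3

/-- ★★ **All three rails are used (even cut).**  An irreducible horizontal bridge of `S₃` (self-avoiding, no renewal index) traverses ALL
THREE rail edges `(a,0,f)–(a,0,t)`, `(a−1,1,t)–(a,1,f)`, `(a−1,2,f)–(a−1,2,t)` across every cut `2a + ½` strictly inside it
(`ξ(head) < 2a < ξ(last)`): the cut is crossed thrice (§1), each crossing is a rail edge, and a rail edge is traversed at most once.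
[cite: DuminilCopinHammond2013, §2.2 (irreducible bridges); DuminilCopinSmirnov2012, §3 (Fig. 3: the strip S_T); lane «pcv-sawmu» a-p2 g25 — own result] -/
theorem trav_even (hc : l.IsChain hvGraph.Adj) (hnd : l.Nodup) (hin : InLev 3 l) (hB : IsHBridge l) (hirr : ∀ i, ¬ IsRenewalIdx l i)
    (a : ℤ) (h0 : xi (l.head hB.1) < 2 * a) (hE : 2 * a < xi (l.getLast hB.1)) :
    Trav l (a, 0, false) (a, 0, true) ∧ Trav l (a - 1, 1, true) (a, 1, false) ∧ Trav l (a - 1, 2, false) (a - 1, 2, true) := by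
  obtain ⟨p, q, r, hpq, hqr, hr, hp1, hp2, hq1, hq2, hr1, hr2, -, -⟩ := three_crossings hc hB hirr h0 hE
  have hp := step_even hc hin (m := p) (by omega) a (Or.inl ⟨hp1, hp2⟩)
  have hq := step_even hc hin (m := q) (by omega) a (Or.inr ⟨hq1, hq2⟩)
  have hr' := step_even hc hin (m := r) hr a (Or.inl ⟨hr1, hr2⟩)
  rcases hp with hp | hp | hp <;> rcases hq with hq | hq | hq <;> rcases hr' with hr' | hr' | hr' <;>
    first
    | exact (false_of_two_traversals hnd (by omega) (by omega) (show p ≠ q by omega) hp hq).elim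
    | exact (false_of_two_traversals hnd (by omega) (by omega) (show p ≠ r by omega) hp hr').elim
    | exact (false_of_two_traversals hnd (by omega) (by omega) (show q ≠ r by omega) hq hr').elim
    | (refine ⟨?_, ?_, ?_⟩ <;>
        first | exact ⟨p, by omega, hp⟩ | exact ⟨q, by omega, hq⟩ | exact ⟨r, hr, hr'⟩)

/-- ★★ **All three rails are used (odd cut).**  The same across every cut `2a + 1 + ½` strictly inside an irreducible bridge of `S₃`:
the edges `(a,0,t)–(a+1,0,f)`, `(a,1,f)–(a,1,t)`, `(a−1,2,t)–(a,2,f)` are all traversed. [cite: DuminilCopinHammond2013, §2.2 (irreducible bridges); DuminilCopinSmirnov2012, §3 (Fig. 3: the strip S_T); lane «pcv-sawmu» a-p2 g25 — own result] -/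
theorem trav_odd (hc : l.IsChain hvGraph.Adj) (hnd : l.Nodup) (hin : InLev 3 l) (hB : IsHBridge l) (hirr : ∀ i, ¬ IsRenewalIdx l i)
    (a : ℤ) (h0 : xi (l.head hB.1) < 2 * a + 1) (hE : 2 * a + 1 < xi (l.getLast hB.1)) :
    Trav l (a, 0, true) (a + 1, 0, false) ∧ Trav l (a, 1, false) (a, 1, true) ∧ Trav l (a - 1, 2, true) (a, 2, false) := by
  obtain ⟨p, q, r, hpq, hqr, hr, hp1, hp2, hq1, hq2, hr1, hr2, -, -⟩ := three_crossings hc hB hirr h0 hE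
  have hp := step_odd hc hin (m := p) (by omega) a (Or.inl ⟨hp1, hp2⟩)
  have hq := step_odd hc hin (m := q) (by omega) a (Or.inr ⟨hq1, hq2⟩)
  have hr' := step_odd hc hin (m := r) hr a (Or.inl ⟨hr1, hr2⟩)
  rcases hp with hp | hp | hp <;> rcases hq with hq | hq | hq <;> rcases hr' with hr' | hr' | hr' <;>
    first
    | exact (false_of_two_traversals hnd (by omega) (by omega) (show p ≠ q by omega) hp hq).elim
    | exact (false_of_two_traversals hnd (by omega) (by omega) (show p ≠ r by omega) hp hr').elim
    | exact (false_of_two_traversals hnd (by omega) (by omega) (show q ≠ r by omega) hq hr').elim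
    | (refine ⟨?_, ?_, ?_⟩ <;>
        first | exact ⟨p, by omega, hp⟩ | exact ⟨q, by omega, hq⟩ | exact ⟨r, hr, hr'⟩)

end W3

end HV

end Literature.Probability.RandomPlanarGeometry.SAW
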